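import Mathlib
import Summits.KontsevichZagierPeriods.Zeta5Search.FamB5Points
import Summits.KontsevichZagierPeriods.Zeta5Search.CellKitCentre
import Summits.KontsevichZagierPeriods.Zeta5Search.ZeroWindowKit
import HarnessLib

/-!
# ζ(5) search — T1-map ray `bRay βB5 n`: zero window `M = 6` (`6 * n < p`, `2 * p < 13 * n`): `T1Rays.FamB5ZeroClassesZ6` (part 1/2)

HONEST FRAMING: systematic search; no irrationality claim unless certified.

Cell `pub-zeta5`, GEN-2 seat generation 19, with p3 g3's window machine (`code/gen/zwgen.py`; gen-2 g16's fork `t1gen` for general rays `bRay β n`,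
g19 copy `pub-zeta5-gen-2/g19/t1gen` with the ray key `B5`; point facts from the ray point kit `T1Rays.FamB5Points`) in the format of typer g14's `Ray4OriginM8*`: exact scale-free
class analysis of the ray `b(n) = n·(23; 11 10 9 8 7 6 5)` on the window `6 * n < p` and `2 * p < 13 * n`
(all odd `p` and all `n ≤ 150`: 2812 instances; class lengths `3 4`; bracket signatures per length
`3:8 4:9`); every statement then PROVED (`omega` leaf by leaf; one LEAF theorem per signature;
decision tree inline in `zw_L*`).  Target: gen-2 g19's `@[conjecture]` node `T1Rays.FamB5ZeroClassesZ6`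
(`ZeroWindowClasses (bRay βB5 n) p 6 …`: deep palindrome(s) `DzB5` and extra pair member(s) `SzB5`) and hence the window
bound `T1Rays.FamB5WindowZ6` (-6) by gen-2 g19's PROVED reduction `T1Rays.famB5WindowZ6_of` (`FamB5Windows.lean`), i.e. the `t = 5` slice
`FamilyTiers.FamilyCellBAt5` of census g11's `CellAtlas.FamilyCellB` (`T1Rays.familyCellBAt5_of_window`).
Integer bookkeeping (`netExp` along residue classes); valuations of rationals; nothing here bears on irrationality.
-/

open Finset

namespace Summit.KontsevichZagierPeriods.Zeta5Search.FamB5Z6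

open Summit.KontsevichZagierPeriods.Zeta5Search.ClusterValuation (netExp classSet CentreIn classExp conjClass classPoleCount)
open Summit.KontsevichZagierPeriods.Zeta5Search.CasoratianValuation (InPolytope shift casoratian)
open Summit.KontsevichZagierPeriods.Zeta5Search.CellKit
open Summit.KontsevichZagierPeriods.Zeta5Search.SecondOrder (classTypeList isRaise classTypeList_level)
open Summit.KontsevichZagierPeriods.Zeta5Search.ZeroWindows
open Summit.KontsevichZagierPeriods.Zeta5Search.T1Rays
open Summit.KontsevichZagierPeriods.Zeta5Search.T1Rays.FamB5Points

variable {p : ℕ} [hp : Fact p.Prime]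

/-- The net exponents of the class points, bracket by bracket (the brackets realised on this window). -/
theorem pointFacts (n p x : ℕ) :
    (x < 5 * n → netExp (bRay βB5 n) (x) = 1) ∧
    (5 * n ≤ x → x < 6 * n → netExp (bRay βB5 n) (x) = 0) ∧
    (6 * n ≤ x → x < 7 * n → netExp (bRay βB5 n) (x) = -1) ∧
    (6 * n ≤ x + p → x + p < 7 * n → netExp (bRay βB5 n) (x + p) = -1) ∧
    (7 * n ≤ x + p → x + p < 8 * n → netExp (bRay βB5 n) (x + p) = -2) ∧
    (8 * n ≤ x + p → x + p < 9 * n → netExp (bRay βB5 n) (x + p) = -3) ∧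
    (9 * n ≤ x + p → x + p < 10 * n → netExp (bRay βB5 n) (x + p) = -4) ∧
    (10 * n ≤ x + p → x + p < 11 * n → netExp (bRay βB5 n) (x + p) = -5) ∧
    (12 * n < x + p → x + p ≤ 13 * n → netExp (bRay βB5 n) (x + p) = -5) ∧
    (11 * n ≤ x + p → x + p ≤ 12 * n → 2 * (x + p) ≠ 23 * n → netExp (bRay βB5 n) (x + p) = -6) ∧
    (2 * (x + p) = 23 * n → netExp (bRay βB5 n) (x + p) = -5) ∧
    (18 * n < x + 2 * p → netExp (bRay βB5 n) (x + 2 * p) = 1) ∧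
    (17 * n < x + 2 * p → x + 2 * p ≤ 18 * n → netExp (bRay βB5 n) (x + 2 * p) = 0) ∧
    (16 * n < x + 2 * p → x + 2 * p ≤ 17 * n → netExp (bRay βB5 n) (x + 2 * p) = -1) ∧
    (15 * n < x + 2 * p → x + 2 * p ≤ 16 * n → netExp (bRay βB5 n) (x + 2 * p) = -2) ∧
    (14 * n < x + 2 * p → x + 2 * p ≤ 15 * n → netExp (bRay βB5 n) (x + 2 * p) = -3) ∧
    (13 * n < x + 2 * p → x + 2 * p ≤ 14 * n → netExp (bRay βB5 n) (x + 2 * p) = -4) ∧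
    (12 * n < x + 2 * p → x + 2 * p ≤ 13 * n → netExp (bRay βB5 n) (x + 2 * p) = -5) ∧
    (18 * n < x + 3 * p → netExp (bRay βB5 n) (x + 3 * p) = 1) := by
  refine ⟨?_, ?_, ?_, ?_, ?_, ?_, ?_, ?_, ?_, ?_, ?_, ?_, ?_, ?_, ?_, ?_, ?_, ?_, ?_⟩
  · exact fun hA => pv_low (n := n) (q := x) hA
  · exact fun hA hB => pv_lo1 (n := n) (q := x) hA hB
  · exact fun hA hB => pv_lo2 (n := n) (q := x) hA hB
  · exact fun hA hB => pv_lo2 (n := n) (q := x + p) hA hB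
  · exact fun hA hB => pv_lo3 (n := n) (q := x + p) hA hB
  · exact fun hA hB => pv_lo4 (n := n) (q := x + p) hA hB
  · exact fun hA hB => pv_lo5 (n := n) (q := x + p) hA hB
  · exact fun hA hB => pv_lo6 (n := n) (q := x + p) hA hB
  · exact fun hA hB => pv_up6 (n := n) (q := x + p) hA hB
  · exact fun hA hB hC => pv_well (n := n) (q := x + p) hA hB hC
  · exact fun hc => pv_cen (n := n) (q := x + p) hc
  · exact fun hA => pv_high (n := n) (q := x + 2 * p) hA
  · exact fun hA hB => pv_up1 (n := n) (q := x + 2 * p) hA hB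
  · exact fun hA hB => pv_up2 (n := n) (q := x + 2 * p) hA hB
  · exact fun hA hB => pv_up3 (n := n) (q := x + 2 * p) hA hB
  · exact fun hA hB => pv_up4 (n := n) (q := x + 2 * p) hA hB
  · exact fun hA hB => pv_up5 (n := n) (q := x + 2 * p) hA hB
  · exact fun hA hB => pv_up6 (n := n) (q := x + 2 * p) hA hB
  · exact fun hA => pv_high (n := n) (q := x + 3 * p) hA

/-- The class exponent of a class of `3` points: level sum plus centre term. -/
theorem classExp_L2 {n x : ℕ} (hx : x < p) (hL : x + 2 * p ≤ 23 * n) (hL' : 23 * n < x + 2 * p + p) :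
    classExp (bRay βB5 n) p x = netExp (bRay βB5 n) (x) + netExp (bRay βB5 n) (x + p) + netExp (bRay βB5 n) (x + 2 * p) +
      (if ¬ (2 : ℤ) ∣ (bRay βB5 n) 0 ∧ CentreIn (bRay βB5 n) p x then (1 : ℤ) else 0) := by
  rw [classExp_eq_levelSum (bRay βB5 n) hx (L := 2) (by rw [b0_toNat]; exact hL) (by rw [b0_toNat]; exact hL')]
  simp only [sum_range_succ, sum_range_zero, zero_add, zero_mul, add_zero, one_mul]

/-- The class exponent of a class of `4` points: level sum plus centre term. -/
theorem classExp_L3 {n x : ℕ} (hx : x < p) (hL : x + 3 * p ≤ 23 * n) (hL' : 23 * n < x + 3 * p + p) :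
    classExp (bRay βB5 n) p x = netExp (bRay βB5 n) (x) + netExp (bRay βB5 n) (x + p) + netExp (bRay βB5 n) (x + 2 * p) +
      netExp (bRay βB5 n) (x + 3 * p) + (if ¬ (2 : ℤ) ∣ (bRay βB5 n) 0 ∧ CentreIn (bRay βB5 n) p x then (1 : ℤ) else 0) := by
  rw [classExp_eq_levelSum (bRay βB5 n) hx (L := 3) (by rw [b0_toNat]; exact hL) (by rw [b0_toNat]; exact hL')]
  simp only [sum_range_succ, sum_range_zero, zero_add, zero_mul, add_zero, one_mul]

set_option maxHeartbeats 400000 in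
/-- Bracket signature 2 of the classes of `3` points: net exponents `(1, -5, -1)`. -/
theorem leaf_L2_2 {n p x : ℕ} (_h1 : 6 * n < p) (_h2 : 2 * p < 13 * n) (_hp2 : p % 2 = 1) (_hx : x < p)
    (_hL : x + 2 * p ≤ 23 * n) (_hL' : 23 * n < x + 2 * p + p) (_ht1 : x < 5 * n) (_ht2 : x + p < 11 * n) (_ht3 : x + 2 * p ≤ 17 * n) :
    x < 5 * n ∧ 10 * n ≤ x + p ∧ x + p < 11 * n ∧ 16 * n < x + 2 * p ∧ x + 2 * p ≤ 17 * n ∧ netExp (bRay βB5 n) (x) = 1 ∧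
      netExp (bRay βB5 n) (x + p) = (-5) ∧ netExp (bRay βB5 n) (x + 2 * p) = (-1) := by
  have hF := pointFacts n p x
  exact ⟨by omega, by omega, by omega, by omega, by omega, hF.1 (by omega), hF.2.2.2.2.2.2.2.1 (by omega) (by omega),
    hF.2.2.2.2.2.2.2.2.2.2.2.2.2.1 (by omega) (by omega)⟩

set_option maxHeartbeats 400000 in
/-- Bracket signature 1 of the classes of `3` points: net exponents `(1, -5, 0)`. -/
theorem leaf_L2_1 {n p x : ℕ} (_h1 : 6 * n < p) (_h2 : 2 * p < 13 * n) (_hp2 : p % 2 = 1) (_hx : x < p)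
    (_hL : x + 2 * p ≤ 23 * n) (_hL' : 23 * n < x + 2 * p + p) (_ht1 : x < 5 * n) (_ht2 : x + p < 11 * n) (_ht3 : ¬ (x + 2 * p ≤ 17 * n)) :
    x < 5 * n ∧ 10 * n ≤ x + p ∧ x + p < 11 * n ∧ 17 * n < x + 2 * p ∧ x + 2 * p ≤ 18 * n ∧ netExp (bRay βB5 n) (x) = 1 ∧
      netExp (bRay βB5 n) (x + p) = (-5) ∧ netExp (bRay βB5 n) (x + 2 * p) = 0 := by
  have hF := pointFacts n p x
  exact ⟨by omega, by omega, by omega, by omega, by omega, hF.1 (by omega), hF.2.2.2.2.2.2.2.1 (by omega) (by omega),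
    hF.2.2.2.2.2.2.2.2.2.2.2.2.1 (by omega) (by omega)⟩

set_option maxHeartbeats 400000 in
/-- Bracket signature 3 of the classes of `3` points: net exponents `(1, -6, 0)`. -/
theorem leaf_L2_3 {n p x : ℕ} (_h1 : 6 * n < p) (_h2 : 2 * p < 13 * n) (_hp2 : p % 2 = 1) (_hx : x < p)
    (_hL : x + 2 * p ≤ 23 * n) (_hL' : 23 * n < x + 2 * p + p) (_ht1 : x < 5 * n) (_ht2 : ¬ (x + p < 11 * n)) :
    x < 5 * n ∧ 11 * n ≤ x + p ∧ x + p ≤ 12 * n ∧ 2 * (x + p) ≠ 23 * n ∧ 17 * n < x + 2 * p ∧ x + 2 * p ≤ 18 * n ∧ netExp (bRay βB5 n) (x) = 1 ∧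
      netExp (bRay βB5 n) (x + p) = (-6) ∧ netExp (bRay βB5 n) (x + 2 * p) = 0 := by
  have hF := pointFacts n p x
  exact ⟨by omega, by omega, by omega, by omega, by omega, by omega, hF.1 (by omega), hF.2.2.2.2.2.2.2.2.2.1 (by omega) (by omega) (by omega),
    hF.2.2.2.2.2.2.2.2.2.2.2.2.1 (by omega) (by omega)⟩

set_option maxHeartbeats 400000 in
/-- Bracket signature 7 of the classes of `3` points: net exponents `(0, -5, 0)`. -/
theorem leaf_L2_7 {n p x : ℕ} (_h1 : 6 * n < p) (_h2 : 2 * p < 13 * n) (_hp2 : p % 2 = 1) (_hx : x < p)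
    (_hL : x + 2 * p ≤ 23 * n) (_hL' : 23 * n < x + 2 * p + p) (_ht1 : ¬ (x < 5 * n)) (_ht2 : x + p ≤ 12 * n) (_ht3 : x + 2 * p ≤ 18 * n)
    (_ht4 : 2 * (x + p) = 23 * n) :
    5 * n ≤ x ∧ x < 6 * n ∧ 2 * (x + p) = 23 * n ∧ 17 * n < x + 2 * p ∧ x + 2 * p ≤ 18 * n ∧ netExp (bRay βB5 n) (x) = 0 ∧
      netExp (bRay βB5 n) (x + p) = (-5) ∧ netExp (bRay βB5 n) (x + 2 * p) = 0 := by
  have hF := pointFacts n p x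
  exact ⟨by omega, by omega, by omega, by omega, by omega, hF.2.1 (by omega) (by omega), hF.2.2.2.2.2.2.2.2.2.2.1 (by omega),
    hF.2.2.2.2.2.2.2.2.2.2.2.2.1 (by omega) (by omega)⟩

set_option maxHeartbeats 400000 in
/-- Bracket signature 6 of the classes of `3` points: net exponents `(0, -6, 0)`. -/
theorem leaf_L2_6 {n p x : ℕ} (_h1 : 6 * n < p) (_h2 : 2 * p < 13 * n) (_hp2 : p % 2 = 1) (_hx : x < p)
    (_hL : x + 2 * p ≤ 23 * n) (_hL' : 23 * n < x + 2 * p + p) (_ht1 : ¬ (x < 5 * n)) (_ht2 : x + p ≤ 12 * n) (_ht3 : x + 2 * p ≤ 18 * n)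
    (_ht4 : ¬ (2 * (x + p) = 23 * n)) :
    5 * n ≤ x ∧ x < 6 * n ∧ 11 * n ≤ x + p ∧ x + p ≤ 12 * n ∧ 2 * (x + p) ≠ 23 * n ∧ 17 * n < x + 2 * p ∧ x + 2 * p ≤ 18 * n ∧
      netExp (bRay βB5 n) (x) = 0 ∧ netExp (bRay βB5 n) (x + p) = (-6) ∧ netExp (bRay βB5 n) (x + 2 * p) = 0 := by
  have hF := pointFacts n p x
  exact ⟨by omega, by omega, by omega, by omega, by omega, by omega, by omega, hF.2.1 (by omega) (by omega),
    hF.2.2.2.2.2.2.2.2.2.1 (by omega) (by omega) (by omega), hF.2.2.2.2.2.2.2.2.2.2.2.2.1 (by omega) (by omega)⟩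

set_option maxHeartbeats 400000 in
/-- Bracket signature 5 of the classes of `3` points: net exponents `(0, -6, 1)`. -/
theorem leaf_L2_5 {n p x : ℕ} (_h1 : 6 * n < p) (_h2 : 2 * p < 13 * n) (_hp2 : p % 2 = 1) (_hx : x < p)
    (_hL : x + 2 * p ≤ 23 * n) (_hL' : 23 * n < x + 2 * p + p) (_ht1 : ¬ (x < 5 * n)) (_ht2 : x + p ≤ 12 * n) (_ht3 : ¬ (x + 2 * p ≤ 18 * n)) :
    5 * n ≤ x ∧ x < 6 * n ∧ 11 * n ≤ x + p ∧ x + p ≤ 12 * n ∧ 2 * (x + p) ≠ 23 * n ∧ 18 * n < x + 2 * p ∧ netExp (bRay βB5 n) (x) = 0 ∧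
      netExp (bRay βB5 n) (x + p) = (-6) ∧ netExp (bRay βB5 n) (x + 2 * p) = 1 := by
  have hF := pointFacts n p x
  exact ⟨by omega, by omega, by omega, by omega, by omega, by omega, hF.2.1 (by omega) (by omega),
    hF.2.2.2.2.2.2.2.2.2.1 (by omega) (by omega) (by omega), hF.2.2.2.2.2.2.2.2.2.2.2.1 (by omega)⟩

set_option maxHeartbeats 400000 in
/-- Bracket signature 4 of the classes of `3` points: net exponents `(0, -5, 1)`. -/
theorem leaf_L2_4 {n p x : ℕ} (_h1 : 6 * n < p) (_h2 : 2 * p < 13 * n) (_hp2 : p % 2 = 1) (_hx : x < p)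
    (_hL : x + 2 * p ≤ 23 * n) (_hL' : 23 * n < x + 2 * p + p) (_ht1 : ¬ (x < 5 * n)) (_ht2 : ¬ (x + p ≤ 12 * n)) (_ht3 : x < 6 * n) :
    5 * n ≤ x ∧ x < 6 * n ∧ 12 * n < x + p ∧ x + p ≤ 13 * n ∧ 18 * n < x + 2 * p ∧ netExp (bRay βB5 n) (x) = 0 ∧ netExp (bRay βB5 n) (x + p) = (-5) ∧
      netExp (bRay βB5 n) (x + 2 * p) = 1 := by
  have hF := pointFacts n p x
  exact ⟨by omega, by omega, by omega, by omega, by omega, hF.2.1 (by omega) (by omega), hF.2.2.2.2.2.2.2.2.1 (by omega) (by omega),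
    hF.2.2.2.2.2.2.2.2.2.2.2.1 (by omega)⟩

set_option maxHeartbeats 400000 in
/-- Bracket signature 8 of the classes of `3` points: net exponents `(-1, -5, 1)`. -/
theorem leaf_L2_8 {n p x : ℕ} (_h1 : 6 * n < p) (_h2 : 2 * p < 13 * n) (_hp2 : p % 2 = 1) (_hx : x < p)
    (_hL : x + 2 * p ≤ 23 * n) (_hL' : 23 * n < x + 2 * p + p) (_ht1 : ¬ (x < 5 * n)) (_ht2 : ¬ (x + p ≤ 12 * n)) (_ht3 : ¬ (x < 6 * n)) :
    6 * n ≤ x ∧ x < 7 * n ∧ 12 * n < x + p ∧ x + p ≤ 13 * n ∧ 18 * n < x + 2 * p ∧ netExp (bRay βB5 n) (x) = (-1) ∧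
      netExp (bRay βB5 n) (x + p) = (-5) ∧ netExp (bRay βB5 n) (x + 2 * p) = 1 := by
  have hF := pointFacts n p x
  exact ⟨by omega, by omega, by omega, by omega, by omega, hF.2.2.1 (by omega) (by omega), hF.2.2.2.2.2.2.2.2.1 (by omega) (by omega),
    hF.2.2.2.2.2.2.2.2.2.2.2.1 (by omega)⟩

set_option maxHeartbeats 400000 in
/-- Bracket signature 2 of the classes of `4` points: net exponents `(1, -1, -5, 1)`. -/
theorem leaf_L3_2 {n p x : ℕ} (_h1 : 6 * n < p) (_h2 : 2 * p < 13 * n) (_hp2 : p % 2 = 1) (_hx : x < p)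
    (_hL : x + 3 * p ≤ 23 * n) (_hL' : 23 * n < x + 3 * p + p) (_ht1 : x + p < 8 * n) (_ht2 : x + p < 7 * n) (_ht3 : x + 2 * p ≤ 13 * n) :
    x < 5 * n ∧ 6 * n ≤ x + p ∧ x + p < 7 * n ∧ 12 * n < x + 2 * p ∧ x + 2 * p ≤ 13 * n ∧ 18 * n < x + 3 * p ∧ netExp (bRay βB5 n) (x) = 1 ∧
      netExp (bRay βB5 n) (x + p) = (-1) ∧ netExp (bRay βB5 n) (x + 2 * p) = (-5) ∧ netExp (bRay βB5 n) (x + 3 * p) = 1 := by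
  have hF := pointFacts n p x
  exact ⟨by omega, by omega, by omega, by omega, by omega, by omega, hF.1 (by omega), hF.2.2.2.1 (by omega) (by omega),
    hF.2.2.2.2.2.2.2.2.2.2.2.2.2.2.2.2.2.1 (by omega) (by omega), hF.2.2.2.2.2.2.2.2.2.2.2.2.2.2.2.2.2.2 (by omega)⟩

set_option maxHeartbeats 400000 in
/-- Bracket signature 1 of the classes of `4` points: net exponents `(1, -1, -4, 1)`. -/
theorem leaf_L3_1 {n p x : ℕ} (_h1 : 6 * n < p) (_h2 : 2 * p < 13 * n) (_hp2 : p % 2 = 1) (_hx : x < p)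
    (_hL : x + 3 * p ≤ 23 * n) (_hL' : 23 * n < x + 3 * p + p) (_ht1 : x + p < 8 * n) (_ht2 : x + p < 7 * n) (_ht3 : ¬ (x + 2 * p ≤ 13 * n)) :
    x < 5 * n ∧ 6 * n ≤ x + p ∧ x + p < 7 * n ∧ 13 * n < x + 2 * p ∧ x + 2 * p ≤ 14 * n ∧ 18 * n < x + 3 * p ∧ netExp (bRay βB5 n) (x) = 1 ∧
      netExp (bRay βB5 n) (x + p) = (-1) ∧ netExp (bRay βB5 n) (x + 2 * p) = (-4) ∧ netExp (bRay βB5 n) (x + 3 * p) = 1 := by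
  have hF := pointFacts n p x
  exact ⟨by omega, by omega, by omega, by omega, by omega, by omega, hF.1 (by omega), hF.2.2.2.1 (by omega) (by omega),
    hF.2.2.2.2.2.2.2.2.2.2.2.2.2.2.2.2.1 (by omega) (by omega), hF.2.2.2.2.2.2.2.2.2.2.2.2.2.2.2.2.2.2 (by omega)⟩

set_option maxHeartbeats 400000 in
/-- Bracket signature 4 of the classes of `4` points: net exponents `(1, -2, -4, 1)`. -/
theorem leaf_L3_4 {n p x : ℕ} (_h1 : 6 * n < p) (_h2 : 2 * p < 13 * n) (_hp2 : p % 2 = 1) (_hx : x < p)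
    (_hL : x + 3 * p ≤ 23 * n) (_hL' : 23 * n < x + 3 * p + p) (_ht1 : x + p < 8 * n) (_ht2 : ¬ (x + p < 7 * n)) (_ht3 : x + 2 * p ≤ 14 * n) :
    x < 5 * n ∧ 7 * n ≤ x + p ∧ x + p < 8 * n ∧ 13 * n < x + 2 * p ∧ x + 2 * p ≤ 14 * n ∧ 18 * n < x + 3 * p ∧ netExp (bRay βB5 n) (x) = 1 ∧
      netExp (bRay βB5 n) (x + p) = (-2) ∧ netExp (bRay βB5 n) (x + 2 * p) = (-4) ∧ netExp (bRay βB5 n) (x + 3 * p) = 1 := by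
  have hF := pointFacts n p x
  exact ⟨by omega, by omega, by omega, by omega, by omega, by omega, hF.1 (by omega), hF.2.2.2.2.1 (by omega) (by omega),
    hF.2.2.2.2.2.2.2.2.2.2.2.2.2.2.2.2.1 (by omega) (by omega), hF.2.2.2.2.2.2.2.2.2.2.2.2.2.2.2.2.2.2 (by omega)⟩

set_option maxHeartbeats 400000 in
/-- Bracket signature 3 of the classes of `4` points: net exponents `(1, -2, -3, 1)`. -/
theorem leaf_L3_3 {n p x : ℕ} (_h1 : 6 * n < p) (_h2 : 2 * p < 13 * n) (_hp2 : p % 2 = 1) (_hx : x < p)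
    (_hL : x + 3 * p ≤ 23 * n) (_hL' : 23 * n < x + 3 * p + p) (_ht1 : x + p < 8 * n) (_ht2 : ¬ (x + p < 7 * n)) (_ht3 : ¬ (x + 2 * p ≤ 14 * n)) :
    x < 5 * n ∧ 7 * n ≤ x + p ∧ x + p < 8 * n ∧ 14 * n < x + 2 * p ∧ x + 2 * p ≤ 15 * n ∧ 18 * n < x + 3 * p ∧ netExp (bRay βB5 n) (x) = 1 ∧
      netExp (bRay βB5 n) (x + p) = (-2) ∧ netExp (bRay βB5 n) (x + 2 * p) = (-3) ∧ netExp (bRay βB5 n) (x + 3 * p) = 1 := by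
  have hF := pointFacts n p x
  exact ⟨by omega, by omega, by omega, by omega, by omega, by omega, hF.1 (by omega), hF.2.2.2.2.1 (by omega) (by omega),
    hF.2.2.2.2.2.2.2.2.2.2.2.2.2.2.2.1 (by omega) (by omega), hF.2.2.2.2.2.2.2.2.2.2.2.2.2.2.2.2.2.2 (by omega)⟩

set_option maxHeartbeats 400000 in
/-- Bracket signature 6 of the classes of `4` points: net exponents `(1, -3, -3, 1)`. -/
theorem leaf_L3_6 {n p x : ℕ} (_h1 : 6 * n < p) (_h2 : 2 * p < 13 * n) (_hp2 : p % 2 = 1) (_hx : x < p)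
    (_hL : x + 3 * p ≤ 23 * n) (_hL' : 23 * n < x + 3 * p + p) (_ht1 : ¬ (x + p < 8 * n)) (_ht2 : x + p < 9 * n) (_ht3 : x + 2 * p ≤ 15 * n) :
    x < 5 * n ∧ 8 * n ≤ x + p ∧ x + p < 9 * n ∧ 14 * n < x + 2 * p ∧ x + 2 * p ≤ 15 * n ∧ 18 * n < x + 3 * p ∧ netExp (bRay βB5 n) (x) = 1 ∧
      netExp (bRay βB5 n) (x + p) = (-3) ∧ netExp (bRay βB5 n) (x + 2 * p) = (-3) ∧ netExp (bRay βB5 n) (x + 3 * p) = 1 := by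
  have hF := pointFacts n p x
  exact ⟨by omega, by omega, by omega, by omega, by omega, by omega, hF.1 (by omega), hF.2.2.2.2.2.1 (by omega) (by omega),
    hF.2.2.2.2.2.2.2.2.2.2.2.2.2.2.2.1 (by omega) (by omega), hF.2.2.2.2.2.2.2.2.2.2.2.2.2.2.2.2.2.2 (by omega)⟩

set_option maxHeartbeats 400000 in
/-- Bracket signature 5 of the classes of `4` points: net exponents `(1, -3, -2, 1)`. -/
theorem leaf_L3_5 {n p x : ℕ} (_h1 : 6 * n < p) (_h2 : 2 * p < 13 * n) (_hp2 : p % 2 = 1) (_hx : x < p)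
    (_hL : x + 3 * p ≤ 23 * n) (_hL' : 23 * n < x + 3 * p + p) (_ht1 : ¬ (x + p < 8 * n)) (_ht2 : x + p < 9 * n) (_ht3 : ¬ (x + 2 * p ≤ 15 * n)) :
    x < 5 * n ∧ 8 * n ≤ x + p ∧ x + p < 9 * n ∧ 15 * n < x + 2 * p ∧ x + 2 * p ≤ 16 * n ∧ 18 * n < x + 3 * p ∧ netExp (bRay βB5 n) (x) = 1 ∧
      netExp (bRay βB5 n) (x + p) = (-3) ∧ netExp (bRay βB5 n) (x + 2 * p) = (-2) ∧ netExp (bRay βB5 n) (x + 3 * p) = 1 := by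
  have hF := pointFacts n p x
  exact ⟨by omega, by omega, by omega, by omega, by omega, by omega, hF.1 (by omega), hF.2.2.2.2.2.1 (by omega) (by omega),
    hF.2.2.2.2.2.2.2.2.2.2.2.2.2.2.1 (by omega) (by omega), hF.2.2.2.2.2.2.2.2.2.2.2.2.2.2.2.2.2.2 (by omega)⟩

set_option maxHeartbeats 400000 in
/-- Bracket signature 8 of the classes of `4` points: net exponents `(1, -4, -2, 1)`. -/
theorem leaf_L3_8 {n p x : ℕ} (_h1 : 6 * n < p) (_h2 : 2 * p < 13 * n) (_hp2 : p % 2 = 1) (_hx : x < p)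
    (_hL : x + 3 * p ≤ 23 * n) (_hL' : 23 * n < x + 3 * p + p) (_ht1 : ¬ (x + p < 8 * n)) (_ht2 : ¬ (x + p < 9 * n))
    (_ht3 : x + p < 10 * n) (_ht4 : x + 2 * p ≤ 16 * n) :
    x < 5 * n ∧ 9 * n ≤ x + p ∧ x + p < 10 * n ∧ 15 * n < x + 2 * p ∧ x + 2 * p ≤ 16 * n ∧ 18 * n < x + 3 * p ∧ netExp (bRay βB5 n) (x) = 1 ∧
      netExp (bRay βB5 n) (x + p) = (-4) ∧ netExp (bRay βB5 n) (x + 2 * p) = (-2) ∧ netExp (bRay βB5 n) (x + 3 * p) = 1 := by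
  have hF := pointFacts n p x
  exact ⟨by omega, by omega, by omega, by omega, by omega, by omega, hF.1 (by omega), hF.2.2.2.2.2.2.1 (by omega) (by omega),
    hF.2.2.2.2.2.2.2.2.2.2.2.2.2.2.1 (by omega) (by omega), hF.2.2.2.2.2.2.2.2.2.2.2.2.2.2.2.2.2.2 (by omega)⟩

set_option maxHeartbeats 400000 in
/-- Bracket signature 7 of the classes of `4` points: net exponents `(1, -4, -1, 1)`. -/
theorem leaf_L3_7 {n p x : ℕ} (_h1 : 6 * n < p) (_h2 : 2 * p < 13 * n) (_hp2 : p % 2 = 1) (_hx : x < p)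
    (_hL : x + 3 * p ≤ 23 * n) (_hL' : 23 * n < x + 3 * p + p) (_ht1 : ¬ (x + p < 8 * n)) (_ht2 : ¬ (x + p < 9 * n))
    (_ht3 : x + p < 10 * n) (_ht4 : ¬ (x + 2 * p ≤ 16 * n)) :
    x < 5 * n ∧ 9 * n ≤ x + p ∧ x + p < 10 * n ∧ 16 * n < x + 2 * p ∧ x + 2 * p ≤ 17 * n ∧ 18 * n < x + 3 * p ∧ netExp (bRay βB5 n) (x) = 1 ∧
      netExp (bRay βB5 n) (x + p) = (-4) ∧ netExp (bRay βB5 n) (x + 2 * p) = (-1) ∧ netExp (bRay βB5 n) (x + 3 * p) = 1 := by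
  have hF := pointFacts n p x
  exact ⟨by omega, by omega, by omega, by omega, by omega, by omega, hF.1 (by omega), hF.2.2.2.2.2.2.1 (by omega) (by omega),
    hF.2.2.2.2.2.2.2.2.2.2.2.2.2.1 (by omega) (by omega), hF.2.2.2.2.2.2.2.2.2.2.2.2.2.2.2.2.2.2 (by omega)⟩

set_option maxHeartbeats 400000 in
/-- Bracket signature 9 of the classes of `4` points: net exponents `(1, -5, -1, 1)`. -/
theorem leaf_L3_9 {n p x : ℕ} (_h1 : 6 * n < p) (_h2 : 2 * p < 13 * n) (_hp2 : p % 2 = 1) (_hx : x < p)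
    (_hL : x + 3 * p ≤ 23 * n) (_hL' : 23 * n < x + 3 * p + p) (_ht1 : ¬ (x + p < 8 * n)) (_ht2 : ¬ (x + p < 9 * n)) (_ht3 : ¬ (x + p < 10 * n)) :
    x < 5 * n ∧ 10 * n ≤ x + p ∧ x + p < 11 * n ∧ 16 * n < x + 2 * p ∧ x + 2 * p ≤ 17 * n ∧ 18 * n < x + 3 * p ∧ netExp (bRay βB5 n) (x) = 1 ∧
      netExp (bRay βB5 n) (x + p) = (-5) ∧ netExp (bRay βB5 n) (x + 2 * p) = (-1) ∧ netExp (bRay βB5 n) (x + 3 * p) = 1 := by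
  have hF := pointFacts n p x
  exact ⟨by omega, by omega, by omega, by omega, by omega, by omega, hF.1 (by omega), hF.2.2.2.2.2.2.2.1 (by omega) (by omega),
    hF.2.2.2.2.2.2.2.2.2.2.2.2.2.1 (by omega) (by omega), hF.2.2.2.2.2.2.2.2.2.2.2.2.2.2.2.2.2.2 (by omega)⟩

end Summit.KontsevichZagierPeriods.Zeta5Search.FamB5Z6
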